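import Mathlib
import HarnessLib
import Literature.Analysis.FluidPDE.ClassicalSolution
import Literature.Analysis.FluidPDE.VectorCalculus
import Literature.Analysis.FluidPDE.NSBoundedMildOseen
import Literature.Analysis.UnboundedOperators.HeatKernel
import Summits.NavierStokesRegularity.NavierStokesRegularity.Theorems.UnthreadedRigidityDoorUnthreadedRigidityMixedPairMagicDefs

/-!
# Route `UnthreadedRigidityDoor`, item `UnthreadedRigidity` (W2, stmt-NavierStokesRegularity-27585) — LINE g11-2 «MIXED PAIR», ADDENDA 2A′/2A″
# (v1.3–v1.4): THE CORELESS (PELL) SECTOR and the AE rungs — typed objects, statements, exact certificates (twin of the sketch, part 3)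

Definition file, part 3 of the twin of `MixedPair_sketch.lean` v1.4 (sha16 fdd225c37c2e9dbd; parts 1/2 = `…MixedPairDefs.lean` / `…MixedPairMagicDefs.lean`):
the R-CORELESS indicial arithmetic `corelessF3Hand` / `corelessF3` / `corelessF3_branches`, `PellBranchPositivity` with its kernel proof
`pellBranchPositivity_holds`, `MagicCorelessRigidity` (G-C′), and the AE rungs `MagicPairOrderTwoRigidityAE`, `MagicWindowReductionAE`,
`MagicPairWindowRigidityAE` (`UniaxialQuadShellAxisym`, S-QU, is in part 1).  Every def/Prop BODY and every proof is VERBATIM from the sketch; namespace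
`…Theorems.UnthreadedRigidity.MixedPair`; shared g10/g11-1 objects opened from the PROFILE/VIRIAL HORN twins as in part 1.  Filed by engine-1 g71
(DIRECTOR-NS dss_147 (3)); author of the statements: planner ns-idea-6 g11/g12 (idea-crit-7 PASS v1.1–v1.4).

WHAT THIS IS NOT: no NS-regularity statement is touched; `UnthreadedRigidity` (27585), W2 and NS regularity stay OPEN; nobody here claims
`UnthreadedRigidity`.  `--supports stmt-NavierStokesRegularity-27585 --as helper`.  [cite: MajdaBertozziCUP2002, §1.1 (vector identities)]
-/

-- the summit and its single sub-problem share the name (CONVENTIONS §1)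
set_option linter.dupNamespace false

namespace Summit.NavierStokesRegularity.NavierStokesRegularity.Theorems.UnthreadedRigidity.MixedPair

open scoped Topology
open Filter Set
open Summit.NavierStokesRegularity.NavierStokesRegularity.Theorems.UnthreadedRigidity.ProfileHorn (E3 threadingFlux IsSliceAxisymmetric)
open Summit.NavierStokesRegularity.NavierStokesRegularity.Theorems.UnthreadedRigidity.VirialHorn (e det3 vortAmpL VirialAdmissible sepShellL
  WindowAxisUniform)

/-! ### ADDENDUM g11-2A′ — CORELESS magic pairs (Pell branches): the leading law, v1.3

CORELESS dipole `H₁ = r^{2m}(1 + …)`, `m ≥ 1` (leading coefficient normalised by NS scaling): `V = c r^{−2} + …`, `c = 2m(2m+3)`; an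
analytic-even linked partner is `H₂ = B r^{2j}(1 + …)` with the indicial identity `2j(2j+5) = 3c` (Pell: `(4j+5)² − 3(4m+3)² = −2`, branches
`(m,j) = (142,246), (27692,47964), (5372250,9305010), …`, one for every `n ≡ 1 (mod 4)`, `n ≥ 5`, in `X + Y√3 = (1+√3)(2+√3)^n`).  LEADING LAW
(hand, exact; machine-checked by an independent pure-rational sparse-series solver `scratch/coreless_germ.py` at the first two branches, both
channels): silence of channel 3 gives, in increasing order, `[Φ₃]_{2m−1} ∝ β₃ ⇒ β₃ = 0`, `[Φ₃]_{2j−1} ∝ B β₂ ⇒ β₂ = 0`, and at the main order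
`[Φ₃]_{4m+2j−1} = c · F₃(m,j) · B` with the explicit rational function `F₃` below (`= 2j − 3m + 2mj − 3m² + (2m+2j+1)p₃/8 − 3m p₂`, `p₃`, `p₂` the
leading particular pressure coefficients); `F₃(142,246) = 731259560/76433489`, `F₃(27692,47964) = 1026814524300577432/526014663925837`, and
`F₃ > 0` at the branches `n = 5, 9, …, 25` (exact rationals), `F₃/m → 0.07050807568877…` along the locus (the `O(m²)` part `2(ρ²−3)/(1+ρ)·m²`,
`ρ = j/m`, cancels exactly at `ρ = √3`).  Channel 1 independently gives `β₁ = 0`, `β₂ = 0`, `[Φ₁]_{4m+2j} = (303782480383809/15674521)·B` at the first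
branch.  So modulo the positivity of ONE explicit rational function on the Pell locus (support S-P, verified far beyond any physical order of
vanishing), EVERY analytic-even magic linked pair silent at order two has `H₂ ≡ 0`: R-CORELESS is reduced to S-P, and with G⁺ the MAGIC residual of
g11-2 is closed at slice level for analytic-even profiles. -/

/-- The leading channel-3 coefficient `F₃(m,j)` of a coreless linked pair on the magic model (ADDENDUM §3′), HAND FORM
(`c = 2m(2m+3)`; `p₃`, `p₂` = leading particular pressure coefficients). -/
def corelessF3Hand (m j : ℚ) : ℚ :=
  2 * j - 3 * m + 2 * m * j - 3 * m ^ 2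
    + (2 * m + 2 * j + 1) / 8 *
        (-4 * (-3 * (2 * m * (2 * m + 3)) + 2 * j * (2 * m * (2 * m + 3)) + 6 * m * (2 * m * (2 * m + 3)) + 30 * m + 28 * m * j) /
          ((2 * m + 2 * j - 2) * (2 * m + 2 * j + 5)))
    - 3 * m * (-4 * m * (2 * m * (2 * m + 3) + 4 * m) / ((4 * m - 2) * (4 * m + 3)))

/-- The same coefficient as ONE rational function `N(m,j)/D(m,j)` (sympy `together`, kit j326078; the two forms agree as rational functions —
kernel-checked below at the two Pell branches, CAS-checked identically). This is the form used in S-P. -/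
def corelessF3 (m j : ℚ) : ℚ :=
  (32*j^3*m^3 + 40*j^3*m^2 - 4*j^3*m - 12*j^3 + 32*j^2*m^4 + 20*j^2*m^3 + 30*j^2*m^2 + 48*j^2*m - 18*j^2
    - 96*j*m^5 - 96*j*m^4 - 70*j*m^3 - 3*j*m^2 + 67*j*m + 30*j - 96*m^6 - 108*m^5 - 117*m^3 + 42*m^2 - 36*m)
  / ((2*m - 1)*(4*m + 3)*(j + m - 1)*(2*j + 2*m + 5))

/-- kernel check of the machine values at the first two Pell branches, in both forms. -/
theorem corelessF3_branches :
    corelessF3 142 246 = 731259560 / 76433489 ∧ corelessF3 27692 47964 = 1026814524300577432 / 526014663925837 ∧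
    corelessF3Hand 142 246 = 731259560 / 76433489 ∧ corelessF3Hand 27692 47964 = 1026814524300577432 / 526014663925837 := by
  refine ⟨?_, ?_, ?_, ?_⟩ <;> norm_num [corelessF3, corelessF3Hand]

/-- SUPPORT S-P «PELL-BRANCH POSITIVITY»: `F₃(m,j) ≠ 0` at every Pell branch — PROVED BELOW (`pellBranchPositivity_holds`, kernel): for `m ≤ 5` the
locus has no natural point; for `m ≥ 6`, `N ≡ N₀(m) + N₁(m)·j` modulo the locus quadratic, `N₁ > 0`, and `N₀ + N₁j > 0` because
`(12m² + 18m + 25/4)N₁² − (−2N₀ + 5N₁/2)²` is a polynomial in `m − 6` with positive coefficients (sympy, kit j326059/j326078, re-proved by `ring`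
+ `positivity`). -/
def PellBranchPositivity : Prop :=
  ∀ m j : ℕ, 1 ≤ m → 2 * j * (2 * j + 5) = 6 * m * (2 * m + 3) → corelessF3 m j ≠ 0

/-- ★ S-P «PELL-BRANCH POSITIVITY» holds (kernel proof: `m ≤ 5` has no Pell branch by case arithmetic; for `m ≥ 6` the
denominator factors are positive and the numerator has a sign). -/
theorem pellBranchPositivity_holds : PellBranchPositivity := by
  intro m j hm h
  by_cases hm6 : m < 6
  · exfalso
    have hj : j ≤ 9 := by nlinarith [h]
    interval_cases m <;> interval_cases j <;> omega
  · push Not at hm6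
    obtain ⟨t, rfl⟩ : ∃ t, m = t + 6 := ⟨m - 6, by omega⟩
    have hLn : (2 * (j:ℚ)) * (2 * j + 5) = 6 * ((t:ℚ) + 6) * (2 * ((t:ℚ) + 6) + 3) := by exact_mod_cast h
    set M : ℚ := (t:ℚ) + 6 with hM
    set J : ℚ := (j:ℚ) with hJ
    have ht : (0:ℚ) ≤ t := Nat.cast_nonneg t
    have hJ0 : 0 ≤ J := Nat.cast_nonneg j
    have hL : 4 * J ^ 2 + 10 * J = 12 * M ^ 2 + 18 * M := by rw [hM]; nlinarith [hLn]
    have hcast : ((t + 6 : ℕ) : ℚ) = M := by push_cast; rfl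
    rw [hcast]
    have hD : (2*M - 1)*(4*M + 3)*(J + M - 1)*(2*J + 2*M + 5) ≠ 0 := by
      have : 0 < (2*M - 1) := by rw [hM]; linarith
      have : 0 < (4*M + 3) := by rw [hM]; linarith
      have : 0 < (J + M - 1) := by rw [hM]; linarith
      have : 0 < (2*J + 2*M + 5) := by rw [hM]; linarith
      positivity
    unfold corelessF3
    rw [div_ne_zero_iff]
    refine ⟨?_, hD⟩
    -- N = N0 + N1 J + Q L with L = 0
    set N0 : ℚ := -144*M^5 - 480*M^4 - 258*M^3 + 339*M^2 + 18*M with hN0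
    set N1 : ℚ := 88*M^4 + 248*M^3 + 118*M^2 - 132*M with hN1
    have hN : (32*J^3*M^3 + 40*J^3*M^2 - 4*J^3*M - 12*J^3 + 32*J^2*M^4 + 20*J^2*M^3 + 30*J^2*M^2 + 48*J^2*M - 18*J^2
        - 96*J*M^5 - 96*J*M^4 - 70*J*M^3 - 3*J*M^2 + 67*J*M + 30*J - 96*M^6 - 108*M^5 - 117*M^3 + 42*M^2 - 36*M)
        = N0 + N1 * J := by
      rw [hN0, hN1]
      linear_combination (8*J*M^3 + 10*J*M^2 - J*M - 3*J + 8*M^4 - 15*M^3 - 35/2*M^2 + 29/2*M + 3) * hL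
    rw [hN]
    -- positivity of N0 + N1 J on the locus for M ≥ 6
    have hN1pos : 0 < N1 := by
      rw [hN1, hM]; nlinarith [pow_nonneg ht 2, pow_nonneg ht 3, pow_nonneg ht 4]
    have hS : 0 < 4 * ((12*M^2 + 18*M + 25/4) * N1^2 - (-2*N0 + 5/2*N1)^2) := by
      have : 4 * ((12*M^2 + 18*M + 25/4) * N1^2 - (-2*N0 + 5/2*N1)^2)
          = 39936*(t:ℚ)^10 + 2330112*(t:ℚ)^9 + 60228096*(t:ℚ)^8 + 905132160*(t:ℚ)^7 + 8715620928*(t:ℚ)^6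
            + 55762800576*(t:ℚ)^5 + 237059492352*(t:ℚ)^4 + 645783998400*(t:ℚ)^3 + 1023332686848*(t:ℚ)^2
            + 720348049152*(t:ℚ) + 4266224640 := by
        rw [hN0, hN1, hM]; ring
      rw [this]; positivity
    intro hzero
    -- from N0 + N1 J = 0: N1 (2J + 5/2) = -2 N0 + 5/2 N1 > 0, square, use hL
    have hV : N1 * (2*J + 5/2) = -2*N0 + 5/2*N1 := by linear_combination 2 * hzero
    have hsq : N1^2 * (4*J^2 + 10*J + 25/4) = (-2*N0 + 5/2*N1)^2 := by
      have : (N1 * (2*J + 5/2))^2 = (-2*N0 + 5/2*N1)^2 := by rw [hV]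
      linear_combination this
    have : N1^2 * (12*M^2 + 18*M + 25/4) = (-2*N0 + 5/2*N1)^2 := by
      rw [← hsq]; linear_combination (-N1^2) * hL
    nlinarith [this, hS]

/-- BRIDGE G-C «MAGIC CORELESS RIGIDITY» (M–L; v1.4 REPAIR of critic P1, idea-crit-7 g7 06:41Z): a CORELESS (`¬ HasCore H₁`, i.e. `H₁(0) = 0`)
but NON-NULL (`¬ IsNullProfile H₁` — v1.3 omitted this and was FALSE AS TYPED by the NULL DIPOLE `H₁ ≡ 0`, `H₂ = B e^{−r²}` on a lone magic uniaxial
shell: linked trivially, silent because the lone uniaxial quadrupole shell is axisymmetric about `b`, yet `H₂ ≢ 0`) analytic-even magic linked pair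
silent at order two has `H₂ ≡ 0`, given S-P.  With `IsAnalyticEven H₁`, `¬ IsNullProfile H₁` is exactly «some Taylor coefficient `a_m ≠ 0`» (identity
theorem on the connected `Ici 0`-neighbourhood), which is what the germ analysis uses.  L = the indicial (Pell) lemma + the leading law above
(`β₃ = 0`, `β₂ = 0`, `c·F₃(m,j)·B = 0`); M = as bridge G. -/
def MagicCorelessRigidity : Prop :=
  PellBranchPositivity →
  ∀ (t₀ T : ℝ) (u : ℝ → E3 → E3) (p : ℝ → E3 → ℝ) (x₀ a : E3) (Q : E3 →L[ℝ] E3) (H₁ H₂ : ℝ → ℝ),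
    t₀ < T →
    Literature.Analysis.FluidPDE.IsClassicalNSSolutionOn (Set.Ico t₀ T) 1 0 u p →
    (∀ t ∈ Set.Ico t₀ T, Tendsto (p t) (cocompact E3) (𝓝 0)) →
    (∀ x : E3, ContDiffWithinAt ℝ 2 (fun t => threadingFlux u x₀ t x) (Set.Ici t₀) t₀) →
    PairAdmissible H₁ H₂ a Q → IsMagic a Q → u t₀ = pairShell H₁ H₂ a Q x₀ →
    IsAnalyticEven H₁ → ¬ HasCore H₁ → ¬ IsNullProfile H₁ → IsAnalyticEven H₂ → IsLinked H₁ H₂ →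
    (∀ x : E3, iteratedDerivWithin 2 (fun t => threadingFlux u x₀ t x) (Set.Ici t₀) t₀ = 0) →
    IsNullProfile H₂

/-- MAGIC SLICE RUNG (AE) — all analytic-even magic pairs (cored or not). -/
def MagicPairOrderTwoRigidityAE : Prop :=
  ∀ (t₀ T : ℝ) (u : ℝ → E3 → E3) (p : ℝ → E3 → ℝ) (x₀ a : E3) (Q : E3 →L[ℝ] E3) (H₁ H₂ : ℝ → ℝ),
    t₀ < T →
    Literature.Analysis.FluidPDE.IsClassicalNSSolutionOn (Set.Ico t₀ T) 1 0 u p →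
    (∀ t ∈ Set.Ico t₀ T, Tendsto (p t) (cocompact E3) (𝓝 0)) →
    (∀ x : E3, ContDiffWithinAt ℝ 2 (fun t => threadingFlux u x₀ t x) (Set.Ici t₀) t₀) →
    PairAdmissible H₁ H₂ a Q → IsMagic a Q → ¬ IsCoaxial a Q → u t₀ = pairShell H₁ H₂ a Q x₀ →
    IsAnalyticEven H₁ → IsAnalyticEven H₂ →
    (∀ x : E3, iteratedDerivWithin 1 (fun t => threadingFlux u x₀ t x) (Set.Ici t₀) t₀ = 0) →
    (∀ x : E3, iteratedDerivWithin 2 (fun t => threadingFlux u x₀ t x) (Set.Ici t₀) t₀ = 0) →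
    IsSliceAxisymmetric (u t₀) x₀

/-- BRIDGE G-W (AE) «MAGIC WINDOW REDUCTION, all slices» (v1.4: conclusion is the DISJUNCTION — critic P1 (ii); as typed in v1.3 it silently
asserted a Liouville statement «no window of lone magic-uniaxial shells with `H₂ ≢ 0`», which is false and which nobody intends to prove): as G-W
without the per-slice core hypothesis (interior analyticity ⇒ analytic-even profiles; S-L; G for cored slices, G-C + S-P for coreless NON-NULL dipole
slices; a slice with NULL dipole is reported as such and handled by S-QU downstream). -/
def MagicWindowReductionAE : Prop :=
  PellBranchPositivity →
  ∀ (S : Set ℝ), IsOpen S → ∀ (u : ℝ → E3 → E3) (x₀ : E3),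
    ContinuousOn (Function.uncurry u) (S ×ˢ Set.univ) →
    (∀ t ∈ S, Literature.Analysis.FluidPDE.VectorCalculus.IsDivFree (u t)) →
    (∀ s ∈ S, ∀ t ∈ S, s < t → ∀ x, u t x =
        Literature.Analysis.UnboundedOperators.heatExtension (u s) (t - s) x
          - Literature.Analysis.FluidPDE.oseenDuhamel 1 s u u t x) →
    (∀ τ ∈ S, ∃ B : ℝ, ∀ t ∈ S, t ≤ τ → ∀ x, ‖u t x‖ ≤ B) →
    (∀ t ∈ S, ∀ x, inner ℝ (Literature.Analysis.FluidPDE.curl (u t) x) (x - x₀) = 0) →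
    ∀ (a : E3) (Q : E3 →L[ℝ] E3) (H₁f H₂f : ℝ → ℝ → ℝ), IsMagic a Q →
    (∀ t ∈ S, PairAdmissible (H₁f t) (H₂f t) a Q ∧ u t = pairShell (H₁f t) (H₂f t) a Q x₀) →
    ∀ t ∈ S, IsNullProfile (H₁f t) ∨ IsNullProfile (H₂f t)

/-- MAGIC WINDOW RUNG (AE) = the crux 27585 VERBATIM restricted to windows all of whose slices are admissible magic pairs about `x₀` over a fixed
axis and shape — no core hypothesis. -/
def MagicPairWindowRigidityAE : Prop :=
  ∀ (S : Set ℝ), IsOpen S → IsPreconnected S → ∀ (u : ℝ → E3 → E3) (x₀ : E3),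
    ContinuousOn (Function.uncurry u) (S ×ˢ Set.univ) →
    (∀ t ∈ S, Literature.Analysis.FluidPDE.VectorCalculus.IsDivFree (u t)) →
    (∀ s ∈ S, ∀ t ∈ S, s < t → ∀ x, u t x =
        Literature.Analysis.UnboundedOperators.heatExtension (u s) (t - s) x
          - Literature.Analysis.FluidPDE.oseenDuhamel 1 s u u t x) →
    (∀ τ ∈ S, ∃ B : ℝ, ∀ t ∈ S, t ≤ τ → ∀ x, ‖u t x‖ ≤ B) →
    (∀ t ∈ S, ∀ x, inner ℝ (Literature.Analysis.FluidPDE.curl (u t) x) (x - x₀) = 0) →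
    (∃ (a : E3) (Q : E3 →L[ℝ] E3) (H₁f H₂f : ℝ → ℝ → ℝ), IsMagic a Q ∧
        ∀ t ∈ S, PairAdmissible (H₁f t) (H₂f t) a Q ∧ u t = pairShell (H₁f t) (H₂f t) a Q x₀) →
    ∃ A : E3 →L[ℝ] E3, (∀ x, inner ℝ (A x) x = 0) ∧ A ≠ 0 ∧
      ∀ t ∈ S, ∀ x, fderiv ℝ (u t) x (A (x - x₀)) - A (u t x) = 0

/-! ### Addendum compositions (kernel-checked) -/

end Summit.NavierStokesRegularity.NavierStokesRegularity.Theorems.UnthreadedRigidity.MixedPair
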